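import Literature.NumberTheory.EllipticCurves.ShaRestriction
import HarnessLib

/-!
# Transport of a local point `E(K_v) → E_L(L_w)` along `K_v → L_w` (`w ∣ v`): a nonzero
# `p`-torsion point of `E(K_v)` stays one in `E_L(L_w)`
# (cell `b2b-bsdres`, team n1011, seat p06 GEN 4; OWNERS row T-E3g-ADD, FILE E — the level-`n`
# plumbing for the additive witnesses of T-E3g-BUDn)

HONEST FRAMING (cell `b2b-bsdres`, run/shared/lean/b2b/bsd-rank1-residual/, verbatim in every
file): the goal of the cell is to DELETE the COMBINATION-SHAPED residual classes of the
Birch–Swinnerton-Dyer formula for ALL analytic-rank `≤ 1` elliptic curves over `ℚ` — "full BSD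
formula for every rank `≤ 1` curve in class `C`" assembled STRICTLY from published theorems — so
that the rank-`≤ 1` remainder becomes exactly the CONSTRUCTION-SHAPED classes, which are TYPED
(missing-input `Prop`s), NOT attempted. This is not "finishing BSD". Team n1011 (N10/N11: X4 ∧
`p = 3`): research routes on CONSTRUCTION-SHAPED classes; nothing is booked by this file.
THEOREMS ONLY: no definition, no named fact, nothing asserted.

## What (row T-E3g-ADD; consumer: p10's T-E3g-BUDn at the additive places of `ℚ_n`)

At a place `w ∣ ℓ` of the layer `K' = ℚ_n` with `ℓ ≠ p` additive for `E/ℚ` and `p ∣ c_ℓ`, the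
additive witness `∃ u ∈ H¹_ur(K'_w, E[p]), u ∉ 𝓚_w`
(`Additive/AdditiveTamagawaWitness.lean`, `…_of_hasAdditiveReductionAt_of_point`) needs, besides
additivity at `w` (unramified base change, `Additive.hasAdditiveReductionAt_baseChange_of_ramificationIdxIn_eq_one`),
ONE nonzero `p`-torsion point of `E_{K'}(K'_w)`. `Additive/TamagawaLocalTorsion.lean` produces a
nonzero `T ∈ E(ℚ_ℓ)` with `p • T = 0` from `p ∣ c_ℓ` over `ℚ`; THIS FILE moves it up: for number
fields `K ⊆ L`, finite places `w ∣ v`, and the continuous extension `K_v → L_w` of `K → L`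
(tree `Literature.NumberTheory.EllipticCurves.adicCompletionMap`), the induced INJECTIVE group
homomorphism `E(K_v) → E_L(L_w)` (Mathlib `WeierstrassCurve.Affine.Point.map`, with
`(E_L)_{L_w} = E_{L_w}`) carries a nonzero point killed by `n` to a nonzero point killed by `n`.
So the Tamagawa hypothesis is used ONCE, over the ground field, and no persistence of `c_w` under
base change is needed at the additive places.

References: J. H. Silverman, *AEC* 2nd ed. (2009) VII.§1, VIII.§1 (points under field extension)
[SilvermanAEC2009]; J.-P. Serre, *Local Fields* II.§3 (completions in extensions)
[SerreLocalFields1979].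
-/

set_option autoImplicit false

noncomputable section

open scoped Classical

open NumberField IsDedekindDomain
open Literature.NumberTheory.EllipticCurves

namespace Summit.BirchSwinnertonDyer.Rank1Residual.Additive

universe u

variable {K : Type u} [Field K] [NumberField K] (W : WeierstrassCurve K)
  (L : Type u) [Field L] [NumberField L] [Algebra K L]
  (v : HeightOneSpectrum (𝓞 K)) (w : HeightOneSpectrum (𝓞 L)) [w.asIdeal.LiesOver v.asIdeal]

/-- **`E(K_v) ↪ E_L(L_w)` preserves "nonzero and killed by `n`"**: for `w ∣ v` and a point
`T ∈ E(K_v)` with `T ≠ 0`, `n • T = 0`, there is `T' ∈ (E_L)(L_w)` with `T' ≠ 0`, `n • T' = 0`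
(the image of `T` under the injective homomorphism induced by `K_v → L_w`; `(E_L)_{L_w} = E_{L_w}`
as Weierstrass equations since `K → L → L_w` and `K → K_v → L_w` agree).
[cite: SilvermanAEC2009, VII.§1 and VIII.§1] -/
theorem exists_point_ne_zero_zsmul_eq_zero_baseChange_adicCompletion_of_liesOver
    {T : (W.baseChange (v.adicCompletion K)).toAffine.Point} (hT : T ≠ 0) {n : ℤ} (hnT : n • T = 0) :
    ∃ T' : ((W.baseChange L).baseChange (w.adicCompletion L)).toAffine.Point, T' ≠ 0 ∧ n • T' = 0 := by
  -- `K_v → L_w` as a `K`-algebra homomorphism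
  let f : v.adicCompletion K →ₐ[K] w.adicCompletion L :=
    { adicCompletionMap (K := K) L v w with
      commutes' := fun x ↦ by
        change adicCompletionMap (K := K) L v w (x : v.adicCompletion K) = _
        rw [adicCompletionMap_coe, IsScalarTower.algebraMap_apply K L (w.adicCompletion L)]
        rfl }
  -- `(E_L)_{L_w} = E_{L_w}` (as equations over `L_w` with its `K`-algebra structure)
  have hLw : (W.baseChange L).baseChange (w.adicCompletion L) = W.baseChange (w.adicCompletion L) :=
    W.map_baseChange (Algebra.ofId L (w.adicCompletion L))
  -- the transported point
  set T₁ : (W.baseChange (w.adicCompletion L)).toAffine.Point :=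
    WeierstrassCurve.Affine.Point.map (W' := W) f T with hT₁
  have hT₁0 : T₁ ≠ 0 := fun h ↦ hT (WeierstrassCurve.Affine.Point.map_injective (W' := W) f
    (by rw [← hT₁, h, map_zero]))
  have hnT₁ : n • T₁ = 0 := by rw [hT₁, ← map_zsmul, hnT, map_zero]
  refine ⟨WeierstrassCurve.Affine.Point.congrEquiv hLw.symm T₁, fun h ↦ hT₁0 ?_, ?_⟩
  · rw [← (WeierstrassCurve.Affine.Point.congrEquiv hLw.symm).map_zero] at h
    exact (WeierstrassCurve.Affine.Point.congrEquiv hLw.symm).injective h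
  · rw [← map_zsmul, hnT₁, map_zero]

end Summit.BirchSwinnertonDyer.Rank1Residual.Additive

end
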